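import Literature.Topology.FourManifolds.TubeLinearReframe
import Mathlib.Analysis.Calculus.MeanValue
import HarnessLib

/-!
# The surgery only depends on the `1`-jet of the tube along the circle

Generic four-manifold infrastructure for the well-definedness of surgery on a framed circle
(Gompf–Stipsicz, *4-Manifolds and Kirby Calculus*, §5.2; Kosinski, *Differential Manifolds*,
VI.1–2: the surgered manifold depends only on the framed circle up to isotopy). We prove the
**jet lemma** `Literature.Topology.FourManifolds.CircleNbhd.nonempty_diffeomorph_surgered_of_jet`: if two tubular
neighbourhoods `ν, ν' : 𝕊¹ × ℝ³ ↪ X` of the same circle `c` are related near the zero section by a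
fibre-preserving map, `ν' (u, w) = ν (u, g_u w)` for `‖w‖ < R`, with `g_u 0 = 0` and
`D g_u (0) = id` (the two tubes induce the same trivialisation of the normal bundle of `c`), then
`ν.Surgered ≃ₘ ν'.Surgered`.

## The argument (Hirsch, *Differential Topology*, Ch. 8 §3: inserting a bump function; Ch. 2 §1:
`C¹`-small perturbations of the identity are diffeomorphisms)

Since `D g_u - id` is continuous on `𝕊¹ × B(0, R)` and vanishes on the compact zero section, it is
uniformly small on `𝕊¹ × B̄(0, r)` for some `r > 0` (`Literature.JetData.exists_radius`). The cut-off
`G_u w := w + χ(w/ρ) (g_u w - w)` (`Literature.Topology.FourManifolds.jetCut`, `ρ rOut = r`) then satisfies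
`‖D G_u - id‖ ≤ 1/2` everywhere (`Literature.Topology.FourManifolds.norm_fderiv_jetCut_sub_id_le`, using the mean value
inequality `‖g_u w - w‖ ≤ η ‖w‖`), so each `G_u` is a diffeomorphism of `ℝ³`
(`Diffeomorph.ofNormFDerivSubIdLe`), equal to `g_u` on `B̄(0, ρ rIn)` and to the identity off
`B(0, r)`; the family is jointly smooth, hence a `TubeDiffeo` (`fibrewiseDiffeomorph`). By
`TubeReparam`, `ν.Surgered ≅ (ν ∘ G).Surgered`; the tube `ν ∘ G` agrees with `ν'` on
`𝕊¹ × B(0, ρ rIn)`, so after shrinking both by the compactly supported contraction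
`w ↦ κ w` (`contractDiffeo`, again `TubeReparam`) they agree on the unit ball bundle, and the
surgeries coincide.

Smoothness in the point of the circle is handled through the angle functions `angA`, `angB`
(`TorusCoordinates`): the hypothesis is stated on the lift `(θ, w) ↦ g_{circlePt θ} w` to
`ℝ × ℝ³`, from which fibrewise derivatives and their continuity are read off in either chart.

## References
* R. E. Gompf, A. I. Stipsicz, *4-Manifolds and Kirby Calculus*, GSM 20 (1999), §5.2.
* M. W. Hirsch, *Differential Topology* (1976), Ch. 2 §1, Ch. 8 §3.
-/

noncomputable section

open scoped Manifold ContDiff Topology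
open Set Function Metric

universe u

namespace Literature.Topology.FourManifolds

/-- Local notation: `𝔼 n` is the model Euclidean space `EuclideanSpace ℝ (Fin n)`. -/
local notation "𝔼 " n:arg => EuclideanSpace ℝ (Fin n)

/-- Local notation: `𝕊 n` is the unit sphere in `EuclideanSpace ℝ (Fin (n + 1))`. -/
local notation "𝕊 " n:arg => (Metric.sphere (0 : EuclideanSpace ℝ (Fin (n + 1))) 1 : Set _)

/-! ### The cut-off of a nonlinear map tangent to the identity -/

section JetCut

variable {E : Type*} [NormedAddCommGroup E] [NormedSpace ℝ E] [FiniteDimensional ℝ E]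
  (χ : ContDiffBump (0 : E)) (ρ : ℝ) (g : E → E)

/-- **The cut-off `y ↦ y + χ(y/ρ) (g y - y)`** of a map `g`: equal to `g` on `B̄(0, ρ rIn)` and
to the identity off `B(0, ρ rOut)`. [cite: Hirsch1976, Ch. 8 §3, proof of Thm 3.1 (inserting a bump function)] -/
def jetCut (y : E) : E := y + cutAt χ ρ y • (g y - y)

variable {ρ}

/-- On the inner ball the cut-off is `g`. [folklore] -/
theorem jetCut_of_norm_le (hρ : 0 < ρ) {y : E} (hy : ‖y‖ ≤ ρ * χ.rIn) : jetCut χ ρ g y = g y := by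
  rw [jetCut, cutAt_eq_one χ hρ hy, one_smul, add_sub_cancel]

/-- Off the outer ball the cut-off is the identity. [folklore] -/
theorem jetCut_of_le_norm (hρ : 0 < ρ) {y : E} (hy : ρ * χ.rOut ≤ ‖y‖) : jetCut χ ρ g y = y := by
  rw [jetCut, cutAt_eq_zero χ hρ hy, zero_smul, add_zero]

variable (ρ) in
/-- The cut-off fixes `0` if `g` does. [folklore] -/
theorem jetCut_apply_zero (h0 : g 0 = 0) : jetCut χ ρ g 0 = 0 := by
  rw [jetCut, h0, sub_zero, smul_zero, add_zero]

/-- Off the outer ball the cut-off is locally the identity. [folklore] -/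
theorem jetCut_eventuallyEq_id (hρ : 0 < ρ) {y : E} (hy : ρ * χ.rOut < ‖y‖) :
    jetCut χ ρ g =ᶠ[𝓝 y] id := by
  have ho : IsOpen {z : E | ρ * χ.rOut < ‖z‖} := isOpen_lt continuous_const continuous_norm
  filter_upwards [ho.mem_nhds hy] with z hz
  exact jetCut_of_le_norm χ g hρ hz.le

variable (ρ) in
/-- The derivative of the cut-off. [folklore] -/
theorem hasFDerivAt_jetCut {y : E} {g' : E →L[ℝ] E} (hg : HasFDerivAt g g' y) :
    HasFDerivAt (jetCut χ ρ g)
      (ContinuousLinearMap.id ℝ E + (cutAt χ ρ y • (g' - ContinuousLinearMap.id ℝ E) +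
        (fderiv ℝ (cutAt χ ρ) y).smulRight (g y - y))) y := by
  have hc : HasFDerivAt (cutAt χ ρ) (fderiv ℝ (cutAt χ ρ) y) y :=
    ((contDiff_cutAt χ).differentiable (by simp) y).hasFDerivAt
  have hL : HasFDerivAt (fun y ↦ g y - y) (g' - ContinuousLinearMap.id ℝ E) y :=
    hg.sub (hasFDerivAt_id y)
  have := (hasFDerivAt_id y).add (hc.smul hL)
  convert this using 1
  funext z
  simp [jetCut]

omit [FiniteDimensional ℝ E] in
/-- **Mean value estimate**: if `g 0 = 0` and `‖D g - id‖ ≤ η` on `B̄(0, r)`, then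
`‖g y - y‖ ≤ η ‖y‖` there. [folklore] -/
theorem norm_sub_self_le_of_fderiv {R r η : ℝ} {g' : E → E →L[ℝ] E}
    (hg : ∀ y, ‖y‖ < R → HasFDerivAt g (g' y) y)
    (hg' : ∀ y, ‖y‖ ≤ r → ‖g' y - ContinuousLinearMap.id ℝ E‖ ≤ η) (hr : r < R) (h0 : g 0 = 0)
    {y : E} (hy : ‖y‖ ≤ r) : ‖g y - y‖ ≤ η * ‖y‖ := by
  have hs : Convex ℝ (closedBall (0 : E) r) := convex_closedBall _ _
  have hf : ∀ x ∈ closedBall (0 : E) r,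
      HasFDerivWithinAt (fun z ↦ g z - z) (g' x - ContinuousLinearMap.id ℝ E) (closedBall (0 : E) r) x :=
    fun x hx ↦ ((hg x (lt_of_le_of_lt (mem_closedBall_zero_iff.1 hx) hr)).sub
      (hasFDerivAt_id x)).hasFDerivWithinAt
  have hb : ∀ x ∈ closedBall (0 : E) r, ‖g' x - ContinuousLinearMap.id ℝ E‖ ≤ η :=
    fun x hx ↦ hg' x (mem_closedBall_zero_iff.1 hx)
  have h := hs.norm_image_sub_le_of_norm_hasFDerivWithin_le hf hb
    (mem_closedBall_zero_iff.2 (by rw [norm_zero]; linarith [norm_nonneg y] : ‖(0 : E)‖ ≤ r))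
    (mem_closedBall_zero_iff.2 hy)
  simpa [h0] using h

/-- **The cut-off is `C¹`-close to the identity**: if `‖D g - id‖ ≤ η` on `B̄(0, ρ rOut)` (and `g`
is differentiable a little beyond, `g 0 = 0`), then `‖D (jetCut) - id‖ ≤ (1 + C rOut) η`
everywhere, `C = bumpBound χ`. [cite: Hirsch1976, Ch. 8 §3, proof of Thm 3.1 (inserting a bump function)] -/
theorem norm_fderiv_jetCut_sub_id_le (hρ : 0 < ρ) {R η : ℝ} (hR : ρ * χ.rOut < R) (hη : 0 ≤ η)
    {g' : E → E →L[ℝ] E} (hg : ∀ y, ‖y‖ < R → HasFDerivAt g (g' y) y)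
    (hg' : ∀ y, ‖y‖ ≤ ρ * χ.rOut → ‖g' y - ContinuousLinearMap.id ℝ E‖ ≤ η) (h0 : g 0 = 0)
    (y : E) :
    ‖fderiv ℝ (jetCut χ ρ g) y - ContinuousLinearMap.id ℝ E‖ ≤ (1 + bumpBound χ * χ.rOut) * η := by
  have hC := bumpBound_nonneg χ
  have hOut := χ.rOut_pos
  by_cases hy : ‖y‖ ≤ ρ * χ.rOut
  · rw [(hasFDerivAt_jetCut χ ρ g (hg y (lt_of_le_of_lt hy hR))).fderiv, add_sub_cancel_left]
    refine (norm_add_le _ _).trans ?_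
    have h1 : ‖cutAt χ ρ y • (g' y - ContinuousLinearMap.id ℝ E)‖ ≤ η := by
      rw [norm_smul]
      calc ‖cutAt χ ρ y‖ * ‖g' y - ContinuousLinearMap.id ℝ E‖ ≤ 1 * η :=
            mul_le_mul (abs_cutAt_le χ y) (hg' y hy) (norm_nonneg _) zero_le_one
        _ = η := one_mul η
    have h2 : ‖(fderiv ℝ (cutAt χ ρ) y).smulRight (g y - y)‖ ≤ bumpBound χ * χ.rOut * η := by
      rw [ContinuousLinearMap.norm_smulRight_apply]
      have h3 : ‖g y - y‖ ≤ η * ‖y‖ := norm_sub_self_le_of_fderiv g hg hg' hR h0 hy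
      calc ‖fderiv ℝ (cutAt χ ρ) y‖ * ‖g y - y‖
          ≤ (bumpBound χ / ρ) * (η * (ρ * χ.rOut)) := by
            refine mul_le_mul (norm_fderiv_cutAt_le χ hρ y) (h3.trans ?_) (norm_nonneg _)
              (div_nonneg hC hρ.le)
            exact mul_le_mul_of_nonneg_left hy hη
        _ = bumpBound χ * χ.rOut * η := by
            field_simp
    calc ‖cutAt χ ρ y • (g' y - ContinuousLinearMap.id ℝ E)‖ +
          ‖(fderiv ℝ (cutAt χ ρ) y).smulRight (g y - y)‖
        ≤ η + bumpBound χ * χ.rOut * η := add_le_add h1 h2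
      _ = (1 + bumpBound χ * χ.rOut) * η := by ring
  · have hy' : ρ * χ.rOut < ‖y‖ := not_le.1 hy
    rw [(jetCut_eventuallyEq_id χ g hρ hy').fderiv_eq, fderiv_id, sub_self, norm_zero]
    positivity

/-- **The cut-off is smooth** when `g` is smooth on a ball beyond the outer radius. [folklore] -/
theorem contDiff_jetCut (hρ : 0 < ρ) {R : ℝ} (hR : ρ * χ.rOut < R) (hg : ContDiffOn ℝ ∞ g (ball 0 R)) :
    ContDiff ℝ ∞ (jetCut χ ρ g) := by
  refine contDiff_iff_contDiffAt.2 fun y ↦ ?_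
  by_cases hy : ‖y‖ < R
  · have h1 : ContDiffAt ℝ ∞ g y := hg.contDiffAt (isOpen_ball.mem_nhds (mem_ball_zero_iff.2 hy))
    exact contDiffAt_id.add ((contDiff_cutAt χ).contDiffAt.smul (h1.sub contDiffAt_id))
  · have hy' : ρ * χ.rOut < ‖y‖ := lt_of_lt_of_le hR (not_lt.1 hy)
    exact contDiffAt_id.congr_of_eventuallyEq (jetCut_eventuallyEq_id χ g hρ hy')

end JetCut

/-! ### Fibre maps over the circle: lifting to the angle -/

section Lift

variable (g : 𝕊 1 → 𝔼 3 → 𝔼 3)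

/-- **The lift of a fibre family to the angle**: `(θ, w) ↦ g_{circlePt θ} w` on `ℝ × ℝ³`. [folklore] -/
def angLift (p : ℝ × 𝔼 3) : 𝔼 3 := g (circlePt p.1) p.2

/-- Each fibre map is the lift at the angle `angA`. [folklore] -/
theorem eq_angLift_angA (u : 𝕊 1) : g u = fun y ↦ angLift g (angA u, y) := by
  funext y
  rw [angLift, circlePt_angA]

/-- Each fibre map is the lift at the angle `angB`. [folklore] -/
theorem eq_angLift_angB (u : 𝕊 1) : g u = fun y ↦ angLift g (angB u, y) := by
  funext y
  rw [angLift, circlePt_angB]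

/-- The domain `ℝ × B(0, R)` of the lift is open. [folklore] -/
theorem isOpen_liftDom (R : ℝ) : IsOpen ((univ : Set ℝ) ×ˢ ball (0 : 𝔼 3) R) :=
  isOpen_univ.prod isOpen_ball

/-- Membership in the domain of the lift. [folklore] -/
theorem mem_liftDom {R θ : ℝ} {y : 𝔼 3} (hy : ‖y‖ < R) :
    (θ, y) ∈ (univ : Set ℝ) ×ˢ ball (0 : 𝔼 3) R :=
  ⟨mem_univ _, mem_ball_zero_iff.2 hy⟩

variable {g} {R : ℝ} (hg : ContDiffOn ℝ ∞ (angLift g) (univ ×ˢ ball 0 R))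
include hg

/-- **Each fibre map is smooth on `B(0, R)`.** [folklore] -/
theorem contDiffOn_fibre (u : 𝕊 1) : ContDiffOn ℝ ∞ (g u) (ball 0 R) := by
  rw [eq_angLift_angA g u]
  exact hg.comp (contDiffOn_const.prodMk contDiffOn_id) fun y hy ↦ ⟨mem_univ _, hy⟩

/-- Each fibre map is differentiable on `B(0, R)`. [folklore] -/
theorem hasFDerivAt_fibre (u : 𝕊 1) {y : 𝔼 3} (hy : ‖y‖ < R) :
    HasFDerivAt (g u) (fderiv ℝ (g u) y) y :=
  (((contDiffOn_fibre hg u).contDiffAt (isOpen_ball.mem_nhds (mem_ball_zero_iff.2 hy))).differentiableAt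
    (by simp)).hasFDerivAt

/-- **The fibre derivative through the chart `angA`.** [folklore] -/
theorem fderiv_fibre_eq_angA (u : 𝕊 1) {y : 𝔼 3} (hy : ‖y‖ < R) :
    fderiv ℝ (g u) y =
      (fderiv ℝ (angLift g) (angA u, y)).comp (ContinuousLinearMap.inr ℝ ℝ (𝔼 3)) := by
  have hd : HasFDerivAt (angLift g) (fderiv ℝ (angLift g) (angA u, y)) (angA u, y) :=
    ((hg.contDiffAt ((isOpen_liftDom R).mem_nhds (mem_liftDom hy))).differentiableAt
      (by simp)).hasFDerivAt
  have h2 : HasFDerivAt (fun y ↦ angLift g (angA u, y))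
      ((fderiv ℝ (angLift g) (angA u, y)).comp (ContinuousLinearMap.inr ℝ ℝ (𝔼 3))) y :=
    hd.comp y (hasFDerivAt_prodMk_right (angA u) y)
  rw [eq_angLift_angA g u]
  exact h2.fderiv

/-- **The fibre derivative through the chart `angB`.** [folklore] -/
theorem fderiv_fibre_eq_angB (u : 𝕊 1) {y : 𝔼 3} (hy : ‖y‖ < R) :
    fderiv ℝ (g u) y =
      (fderiv ℝ (angLift g) (angB u, y)).comp (ContinuousLinearMap.inr ℝ ℝ (𝔼 3)) := by
  have hd : HasFDerivAt (angLift g) (fderiv ℝ (angLift g) (angB u, y)) (angB u, y) :=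
    ((hg.contDiffAt ((isOpen_liftDom R).mem_nhds (mem_liftDom hy))).differentiableAt
      (by simp)).hasFDerivAt
  have h2 : HasFDerivAt (fun y ↦ angLift g (angB u, y))
      ((fderiv ℝ (angLift g) (angB u, y)).comp (ContinuousLinearMap.inr ℝ ℝ (𝔼 3))) y :=
    hd.comp y (hasFDerivAt_prodMk_right (angB u) y)
  rw [eq_angLift_angB g u]
  exact h2.fderiv

/-- The derivative of the lift is continuous on the domain. [folklore] -/
theorem continuousOn_fderiv_angLift : ContinuousOn (fderiv ℝ (angLift g)) (univ ×ˢ ball 0 R) :=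
  hg.continuousOn_fderiv_of_isOpen (isOpen_liftDom R) (by simp)

/-- **The fibre derivative `(u, y) ↦ D g_u (y)` is jointly continuous** on `𝕊¹ × B(0, R)` (read
through `angA` off `ptA` and through `angB` off `ptB`). [folklore] -/
theorem continuousAt_fderiv_fibre {u : 𝕊 1} {y : 𝔼 3} (hy : ‖y‖ < R) :
    ContinuousAt (fun p : (𝕊 1) × 𝔼 3 ↦ fderiv ℝ (g p.1) p.2) (u, y) := by
  have hnhds : (univ : Set (𝕊 1)) ×ˢ ball (0 : 𝔼 3) R ∈ 𝓝 (u, y) :=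
    (isOpen_univ.prod isOpen_ball).mem_nhds ⟨mem_univ _, mem_ball_zero_iff.2 hy⟩
  rcases ne_ptA_or_ne_ptB u with hA | hB
  · have hev : (fun p : (𝕊 1) × 𝔼 3 ↦ fderiv ℝ (g p.1) p.2) =ᶠ[𝓝 (u, y)]
        fun p ↦ (fderiv ℝ (angLift g) (angA p.1, p.2)).comp (ContinuousLinearMap.inr ℝ ℝ (𝔼 3)) := by
      filter_upwards [hnhds] with p hp
      exact fderiv_fibre_eq_angA hg p.1 (mem_ball_zero_iff.1 hp.2)
    refine ContinuousAt.congr_of_eventuallyEq ?_ hev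
    have h1 : ContinuousAt (fun p : (𝕊 1) × 𝔼 3 ↦ (angA p.1, p.2)) (u, y) := by
      refine ContinuousAt.prodMk ?_ continuousAt_snd
      exact ContinuousAt.comp (f := Prod.fst) (g := angA) (x := (u, y))
        (contMDiffAt_angA hA).continuousAt continuousAt_fst
    have h2 : ContinuousAt (fderiv ℝ (angLift g)) (angA u, y) :=
      (continuousOn_fderiv_angLift hg).continuousAt ((isOpen_liftDom R).mem_nhds (mem_liftDom hy))
    have h3 := ContinuousAt.comp (f := fun p : (𝕊 1) × 𝔼 3 ↦ (angA p.1, p.2)) (x := (u, y)) h2 h1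
    exact h3.clm_comp continuousAt_const
  · have hev : (fun p : (𝕊 1) × 𝔼 3 ↦ fderiv ℝ (g p.1) p.2) =ᶠ[𝓝 (u, y)]
        fun p ↦ (fderiv ℝ (angLift g) (angB p.1, p.2)).comp (ContinuousLinearMap.inr ℝ ℝ (𝔼 3)) := by
      filter_upwards [hnhds] with p hp
      exact fderiv_fibre_eq_angB hg p.1 (mem_ball_zero_iff.1 hp.2)
    refine ContinuousAt.congr_of_eventuallyEq ?_ hev
    have h1 : ContinuousAt (fun p : (𝕊 1) × 𝔼 3 ↦ (angB p.1, p.2)) (u, y) := by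
      refine ContinuousAt.prodMk ?_ continuousAt_snd
      exact ContinuousAt.comp (f := Prod.fst) (g := angB) (x := (u, y))
        (contMDiffAt_angB hB).continuousAt continuousAt_fst
    have h2 : ContinuousAt (fderiv ℝ (angLift g)) (angB u, y) :=
      (continuousOn_fderiv_angLift hg).continuousAt ((isOpen_liftDom R).mem_nhds (mem_liftDom hy))
    have h3 := ContinuousAt.comp (f := fun p : (𝕊 1) × 𝔼 3 ↦ (angB p.1, p.2)) (x := (u, y)) h2 h1
    exact h3.clm_comp continuousAt_const

/-- **The family is jointly smooth on `𝕊¹ × B(0, R)`** (as a map of the product manifold). [folklore] -/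
theorem contMDiffAt_uncurry {u : 𝕊 1} {y : 𝔼 3} (hy : ‖y‖ < R) :
    ContMDiffAt ((𝓡 1).prod 𝓘(ℝ, 𝔼 3)) 𝓘(ℝ, 𝔼 3) ∞ (uncurry g) (u, y) := by
  have hĝ : ∀ θ, ContDiffAt ℝ ∞ (angLift g) (θ, y) := fun θ ↦
    hg.contDiffAt ((isOpen_liftDom R).mem_nhds (mem_liftDom hy))
  rcases ne_ptA_or_ne_ptB u with hA | hB
  · have heq : uncurry g = angLift g ∘ fun p : (𝕊 1) × 𝔼 3 ↦ (angA p.1, p.2) := by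
      funext ⟨v, z⟩
      show g v z = angLift g (angA v, z)
      rw [eq_angLift_angA g v]
    rw [heq]
    have h1 : ContMDiffAt ((𝓡 1).prod 𝓘(ℝ, 𝔼 3)) 𝓘(ℝ, ℝ × 𝔼 3) ∞
        (fun p : (𝕊 1) × 𝔼 3 ↦ (angA p.1, p.2)) (u, y) :=
      ((contMDiffAt_angA hA).comp (u, y) contMDiffAt_fst).prodMk_space contMDiffAt_snd
    exact ContDiffAt.comp_contMDiffAt (f := fun p : (𝕊 1) × 𝔼 3 ↦ (angA p.1, p.2))
      (x := (u, y)) (hĝ (angA u)) h1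
  · have heq : uncurry g = angLift g ∘ fun p : (𝕊 1) × 𝔼 3 ↦ (angB p.1, p.2) := by
      funext ⟨v, z⟩
      show g v z = angLift g (angB v, z)
      rw [eq_angLift_angB g v]
    rw [heq]
    have h1 : ContMDiffAt ((𝓡 1).prod 𝓘(ℝ, 𝔼 3)) 𝓘(ℝ, ℝ × 𝔼 3) ∞
        (fun p : (𝕊 1) × 𝔼 3 ↦ (angB p.1, p.2)) (u, y) :=
      ((contMDiffAt_angB hB).comp (u, y) contMDiffAt_fst).prodMk_space contMDiffAt_snd
    exact ContDiffAt.comp_contMDiffAt (f := fun p : (𝕊 1) × 𝔼 3 ↦ (angB p.1, p.2))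
      (x := (u, y)) (hĝ (angB u)) h1

/-- **A uniform radius of `C¹`-closeness to the identity.** If `D g_u (0) = id` for all `u`, then
for every `η > 0` there is `r ∈ (0, R)` with `‖D g_u (y) - id‖ ≤ η` for all `u` and `‖y‖ ≤ r`
(continuity of the fibre derivative, compactness of the circle, tube lemma). [folklore] -/
theorem exists_radius_norm_fderiv_sub_id_le (hR : 0 < R)
    (h1 : ∀ u, fderiv ℝ (g u) 0 = ContinuousLinearMap.id ℝ (𝔼 3)) {η : ℝ} (hη : 0 < η) :
    ∃ r, 0 < r ∧ r < R ∧ ∀ u (y : 𝔼 3), ‖y‖ ≤ r →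
      ‖fderiv ℝ (g u) y - ContinuousLinearMap.id ℝ (𝔼 3)‖ ≤ η := by
  set V : Set ((𝕊 1) × 𝔼 3) :=
    {p | ‖p.2‖ < R ∧ ‖fderiv ℝ (g p.1) p.2 - ContinuousLinearMap.id ℝ (𝔼 3)‖ < η} with hV
  have hVo : IsOpen V := by
    rw [isOpen_iff_mem_nhds]
    rintro ⟨u, y⟩ ⟨hy, hlt⟩
    have hc := continuousAt_fderiv_fibre hg (u := u) hy
    have h1 : {p : (𝕊 1) × 𝔼 3 | ‖p.2‖ < R} ∈ 𝓝 (u, y) :=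
      (isOpen_lt (continuous_norm.comp continuous_snd) continuous_const).mem_nhds hy
    have h2 : {p : (𝕊 1) × 𝔼 3 |
        ‖fderiv ℝ (g p.1) p.2 - ContinuousLinearMap.id ℝ (𝔼 3)‖ < η} ∈ 𝓝 (u, y) :=
      hc.preimage_mem_nhds ((isOpen_lt (continuous_norm.comp (continuous_id.sub continuous_const))
        continuous_const).mem_nhds hlt)
    exact Filter.inter_mem h1 h2
  have hsub : (univ : Set (𝕊 1)) ×ˢ ({0} : Set (𝔼 3)) ⊆ V := by
    rintro ⟨u, y⟩ ⟨-, hy⟩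
    rw [mem_singleton_iff] at hy
    subst hy
    refine ⟨by simpa using hR, ?_⟩
    show ‖fderiv ℝ (g u) 0 - ContinuousLinearMap.id ℝ (𝔼 3)‖ < η
    rw [h1 u, sub_self, norm_zero]
    exact hη
  obtain ⟨U₁, V₂, -, hV₂, hsU, htV, hUV⟩ :=
    generalized_tube_lemma isCompact_univ isCompact_singleton hVo hsub
  obtain ⟨r₂, hr₂, hball⟩ := Metric.isOpen_iff.1 hV₂ 0 (htV (mem_singleton 0))
  refine ⟨min (r₂ / 2) (R / 2), by positivity, ?_, fun u y hy ↦ ?_⟩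
  · exact lt_of_le_of_lt (min_le_right _ _) (by linarith)
  · have hyV : (u, y) ∈ V := by
      refine hUV ⟨hsU (mem_univ u), hball (mem_ball_zero_iff.2 ?_)⟩
      exact lt_of_le_of_lt hy (lt_of_le_of_lt (min_le_left _ _) (by linarith))
    exact hyV.2.le

end Lift

/-! ### The cut-off family as a tube reparametrisation -/

section Family

variable {g : 𝕊 1 → 𝔼 3 → 𝔼 3} {R : ℝ} (hg : ContDiffOn ℝ ∞ (angLift g) (univ ×ˢ ball 0 R))
  {ρ : ℝ} (hρ : 0 < ρ) (hR : ρ * (coreBump (E := 𝔼 3)).rOut < R)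
include hg hρ hR

/-- **The cut-off family `(u, y) ↦ jetCut χ ρ g_u y` is jointly smooth** on `𝕊¹ × ℝ³`. [folklore] -/
theorem contMDiff_uncurry_jetCut :
    ContMDiff ((𝓡 1).prod 𝓘(ℝ, 𝔼 3)) 𝓘(ℝ, 𝔼 3) ∞
      (uncurry fun u ↦ jetCut coreBump ρ (g u)) := by
  rintro ⟨u, y⟩
  by_cases hy : ‖y‖ < R
  · have h1 : ContMDiffAt ((𝓡 1).prod 𝓘(ℝ, 𝔼 3)) 𝓘(ℝ, ℝ) ∞
        (fun p : (𝕊 1) × 𝔼 3 ↦ cutAt coreBump ρ p.2) (u, y) :=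
      ((contDiff_cutAt (coreBump (E := 𝔼 3))).contMDiff.comp contMDiff_snd).contMDiffAt
    have h2 : ContMDiffAt ((𝓡 1).prod 𝓘(ℝ, 𝔼 3)) 𝓘(ℝ, 𝔼 3) ∞
        (fun p : (𝕊 1) × 𝔼 3 ↦ g p.1 p.2 - p.2) (u, y) :=
      (contMDiffAt_uncurry hg (u := u) hy).sub contMDiffAt_snd
    exact contMDiffAt_snd.add (h1.smul h2)
  · have hy' : ρ * (coreBump (E := 𝔼 3)).rOut < ‖y‖ := lt_of_lt_of_le hR (not_lt.1 hy)
    have ho : IsOpen {p : (𝕊 1) × 𝔼 3 | ρ * (coreBump (E := 𝔼 3)).rOut < ‖p.2‖} :=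
      isOpen_lt continuous_const (continuous_norm.comp continuous_snd)
    have hev : (uncurry fun u ↦ jetCut coreBump ρ (g u)) =ᶠ[𝓝 (u, y)] fun p ↦ p.2 := by
      filter_upwards [ho.mem_nhds hy'] with p hp
      exact jetCut_of_le_norm _ _ hρ hp.le
    exact contMDiffAt_snd.congr_of_eventuallyEq hev

variable (h0 : ∀ u, g u 0 = 0)
  (hder : ∀ u (y : 𝔼 3), ‖y‖ ≤ ρ * (coreBump (E := 𝔼 3)).rOut →
    ‖fderiv ℝ (g u) y - ContinuousLinearMap.id ℝ (𝔼 3)‖ ≤ straightenThreshold (coreBump (E := 𝔼 3)))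
include h0 hder

/-- **Each cut-off map is within `1/2` of the identity in `C¹`.** [cite: Hirsch1976, Ch. 8 §3, proof of Thm 3.1 (inserting a bump function)] -/
theorem norm_fderiv_jetCut_fibre_sub_id_le (u : 𝕊 1) (y : 𝔼 3) :
    ‖fderiv ℝ (jetCut coreBump ρ (g u)) y - ContinuousLinearMap.id ℝ (𝔼 3)‖ ≤ 1 / 2 := by
  have h := norm_fderiv_jetCut_sub_id_le coreBump (g u) hρ hR (straightenThreshold_pos _).le
    (fun z hz ↦ hasFDerivAt_fibre hg u hz) (hder u) (h0 u) y
  refine h.trans (le_of_eq ?_)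
  have h0' : 0 < 1 + bumpBound (coreBump (E := 𝔼 3)) * (coreBump (E := 𝔼 3)).rOut := by
    have := bumpBound_nonneg (coreBump (E := 𝔼 3))
    have := (coreBump (E := 𝔼 3)).rOut_pos
    positivity
  unfold straightenThreshold
  field_simp

/-- **Each cut-off map as a diffeomorphism of `ℝ³`.** [cite: Hirsch1976, Ch. 2 Lemma 1.3 and Thm. 1.6] -/
def jetCutDiffeo (u : 𝕊 1) : 𝔼 3 ≃ₘ⟮𝓘(ℝ, 𝔼 3), 𝓘(ℝ, 𝔼 3)⟯ 𝔼 3 :=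
  Diffeomorph.ofNormFDerivSubIdLe (jetCut coreBump ρ (g u))
    (contDiff_jetCut coreBump (g u) hρ hR (contDiffOn_fibre hg u)) (by simp)
    (norm_fderiv_jetCut_fibre_sub_id_le hg hρ hR h0 hder u)

/-- The cut-off diffeomorphism as a function (definitional). [folklore] -/
@[simp] theorem coe_jetCutDiffeo (u : 𝕊 1) : ⇑(jetCutDiffeo hg hρ hR h0 hder u) = jetCut coreBump ρ (g u) :=
  rfl

/-- **The cut-off family as a `TubeDiffeo`** (radius `ρ rOut`). [cite: GompfStipsiczGSM1999, §5.2] -/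
def jetTubeDiffeo : TubeDiffeo where
  toDiffeomorph := fibrewiseDiffeomorph (contMDiff_uncurry_jetCut hg hρ hR)
    (fun u ↦ (jetCutDiffeo hg hρ hR h0 hder u).isLocalDiffeomorph)
    (fun u ↦ (jetCutDiffeo hg hρ hR h0 hder u).bijective)
  radius := ρ * (coreBump (E := 𝔼 3)).rOut
  apply_zero u := by
    rw [coe_fibrewiseDiffeomorph, fibrewiseFun_apply, jetCut_apply_zero _ _ _ (h0 u)]
  eq_self p hp := by
    rw [coe_fibrewiseDiffeomorph]
    exact Prod.ext rfl (jetCut_of_le_norm _ _ hρ hp)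

/-- The cut-off reparametrisation, pointwise. [folklore] -/
@[simp] theorem jetTubeDiffeo_apply (u : 𝕊 1) (w : 𝔼 3) :
    (jetTubeDiffeo hg hρ hR h0 hder).toDiffeomorph (u, w) = (u, jetCut coreBump ρ (g u) w) := rfl

end Family

/-! ### The shrink `w ↦ κ w` as a tube reparametrisation -/

section Shrink

/-- **The compactly supported shrink by `κ ∈ (0, 1]`**: `contractDiffeo` at scale `2/7` (equal to
`κ •` on the closed unit ball, to the identity off `B(0, 8/7)`), as a `TubeDiffeo`. [cite: Hirsch1976, Ch. 8 §3, proof of Thm 3.1 (inserting a bump function)] -/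
def shrinkTubeDiffeo (κ : ℝ) : TubeDiffeo :=
  TubeDiffeo.ofFibre (contractDiffeo (by norm_num : (0 : ℝ) < 2 / 7) κ) (8 / 7)
    (contractDiffeo_apply_zero _ _) (fun _ hw ↦ contractDiffeo_of_le_norm _ _ (by linarith))

/-- On the unit ball the shrink is `w ↦ κ w`. [folklore] -/
theorem shrinkTubeDiffeo_apply {κ : ℝ} (hκ : 0 < κ) (hκ1 : κ ≤ 1) (u : 𝕊 1) {w : 𝔼 3}
    (hw : ‖w‖ ≤ 1) : (shrinkTubeDiffeo κ).toDiffeomorph (u, w) = (u, κ • w) := by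
  rw [shrinkTubeDiffeo, TubeDiffeo.ofFibre_apply, contractDiffeo_of_norm_le _ hκ hκ1 (by linarith)]

end Shrink

/-! ### The jet lemma -/

section Jet

variable {X : Type u} [TopologicalSpace X] [ChartedSpace (𝔼 4) X] [T2Space X]
  [IsManifold (𝓡 4) ∞ X] {c : 𝕊 1 → X}

/-- **The surgery only depends on the `1`-jet of the tube along the circle.** Let `ν, ν'` be
tubular neighbourhoods of the same circle `c` with `ν' (u, w) = ν (u, g_u w)` for `‖w‖ < R`,
where the fibre maps `g_u` fix `0`, have derivative `id` at `0`, and lift to a smooth map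
`(θ, w) ↦ g_{circlePt θ} w` on `ℝ × B(0, R)`. Then `ν.Surgered ≃ₘ ν'.Surgered`. [cite: GompfStipsiczGSM1999, §5.2] -/
theorem CircleNbhd.nonempty_diffeomorph_surgered_of_jet (ν ν' : CircleNbhd (𝓡 4) c)
    (g : 𝕊 1 → 𝔼 3 → 𝔼 3) {R : ℝ} (hR : 0 < R)
    (hg : ContDiffOn ℝ ∞ (angLift g) (univ ×ˢ ball 0 R)) (h0 : ∀ u, g u 0 = 0)
    (h1 : ∀ u, fderiv ℝ (g u) 0 = ContinuousLinearMap.id ℝ (𝔼 3))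
    (hνν' : ∀ u (w : 𝔼 3), ‖w‖ < R → ν'.toFun (u, w) = ν.toFun (u, g u w)) :
    Nonempty (ν.Surgered ≃ₘ⟮𝓡 4, 𝓡 4⟯ ν'.Surgered) := by
  -- a uniform radius of `C¹`-closeness
  obtain ⟨r, hr, hrR, hder⟩ := exists_radius_norm_fderiv_sub_id_le hg hR h1
    (straightenThreshold_pos (coreBump (E := 𝔼 3)))
  set ρ : ℝ := r / (coreBump (E := 𝔼 3)).rOut with hρdef
  have hOut : (coreBump (E := 𝔼 3)).rOut = 17 / 5 := rfl
  have hIn : (coreBump (E := 𝔼 3)).rIn = 3 := rfl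
  have hρ : 0 < ρ := div_pos hr (coreBump (E := 𝔼 3)).rOut_pos
  have hρr : ρ * (coreBump (E := 𝔼 3)).rOut = r := div_mul_cancel₀ _ (coreBump (E := 𝔼 3)).rOut_pos.ne'
  have hρR : ρ * (coreBump (E := 𝔼 3)).rOut < R := by rw [hρr]; exact hrR
  have hder' : ∀ u (y : 𝔼 3), ‖y‖ ≤ ρ * (coreBump (E := 𝔼 3)).rOut →
      ‖fderiv ℝ (g u) y - ContinuousLinearMap.id ℝ (𝔼 3)‖ ≤ straightenThreshold (coreBump (E := 𝔼 3)) :=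
    fun u y hy ↦ hder u y (by rwa [hρr] at hy)
  -- the cut-off reparametrisation and the shrink
  set T := jetTubeDiffeo hg hρ hρR h0 hder' with hT
  set κ : ℝ := min (ρ * 3) 1 with hκ
  have hκpos : 0 < κ := lt_min (by positivity) one_pos
  have hκ1 : κ ≤ 1 := min_le_right _ _
  have hκρ : κ ≤ ρ * 3 := min_le_left _ _
  -- `ν ≅ ν ∘ T ≅ ν' ∘ K ≅ ν'`
  obtain ⟨e₁⟩ := ν.nonempty_diffeomorph_surgered_twist T
  obtain ⟨e₃⟩ := ν'.nonempty_diffeomorph_surgered_twist (shrinkTubeDiffeo κ)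
  obtain ⟨e₂⟩ := (ν.twist T).nonempty_diffeomorph_surgered_of_eqOn_twist (shrinkTubeDiffeo κ)
    (ν'.twist (shrinkTubeDiffeo κ)) (fun u w hw ↦ by
      have hκw : ‖κ • w‖ ≤ κ := by
        rw [norm_smul, Real.norm_of_nonneg hκpos.le]
        exact mul_le_of_le_one_right hκpos.le hw.le
      have hin : ‖κ • w‖ ≤ ρ * (coreBump (E := 𝔼 3)).rIn := by rw [hIn]; linarith
      have hlt : ‖κ • w‖ < R := by
        have : ρ * 3 < R := by
          have h17 : ρ * 3 ≤ ρ * (17 / 5) := by nlinarith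
          rw [hOut] at hρR
          linarith
        linarith
      rw [CircleNbhd.twist_apply, CircleNbhd.twist_apply, shrinkTubeDiffeo_apply hκpos hκ1 u hw.le,
        hT, jetTubeDiffeo_apply, jetCut_of_norm_le _ _ hρ hin]
      exact hνν' u _ hlt)
  exact ⟨e₁.trans (e₂.trans e₃.symm)⟩

end Jet

end Literature.Topology.FourManifolds
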